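import Summits.BirchSwinnertonDyer.BirchSwinnertonDyer.Theorems.PrintCFramBottomClassIndexLawFiveLeFlipRungMatrixFactorisation
import Literature.NumberTheory.EllipticCurves.HalfIntegralWeightFormsProofs
import HarnessLib

/-!
# Crux `PrintCFram.BottomClassIndexLawFiveLe` (stmt-BirchSwinnertonDyer-20372), line `eisenstein-resource-bdp-line` (registry v29 `stub_flipRungs.2`,
# the `8 ∣ m` half = LEAD's residual `stub_rungTwoEight` / w6 g10's (JMLTwoEight⁶)):
# THE 2-ADIC FLIPPED-CUSP RUNG FOR `e = v₂(m) = 3`, piece P6a/P6c — THE MATRICES AND THE ODD-TRANSLATE FLIP IDENTITY AT MODULUS `16`,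
# read through `W₁₆ = γ₀·diag(256, 1)`, `γ₀ = [[a, b],[M′, 256]]`
# (cell `bsd-print-cfram`, width seat `bsd-line-cfram-p1-w8` g10; THEOREMS ONLY, `--supports` 20372 `--as helper`; BSD is not proved by any of this)

HONEST FRAMING. Nothing here is a statement about BSD, elliptic curves or Bernoulli numbers; no registered stub is closed. This is the `R = 16`
twin of w7 g8's P1 (`…FlipRungTwoFlipIdentity`, `R = 8`) for the `e = 3` (`8 ∣ m`) half of the 2-adic rung (crux notes
`Lines/eisenstein-resource-bdp-line-w7g8-T6.md` §5c P6; w6 g10's scope correction 11:04:52Z: the `e = 2` vehicle cannot separate the classes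
`14m₁`, `6m₁ (mod 16)` of `n = 2m₁r`, `r ≡ 7, 3 (mod 8)`). THE ROAD (w8 g10): cut `g = G|U_4` at modulus `16` and flip at
`W₁₆ = γ₀·diag(256,1)`, `γ₀ = [[a, b],[M′, 256]] ∈ SL₂(ℤ)` (`256a − M′b = 1`, `M′` odd). The matrices are w2 g14's T2
(`…FlipRungMatrixFactorisation.translate_mul_fricke_eq`) AT `q = 4`: for odd `j` and any solution `y` of `j·M′·y ≡ b (mod 16)` (equivalently
`M′²·j·y ≡ −1`),

    [[16, j],[0, 16]] · [[256a, b],[256M′, 256]] = γ_j · [[256, 16y],[0, 256]],   γ_j = [[16a + jM′, c + j − ay],[16M′, 16 − M′y]] ∈ Γ₀(16M′),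

`16c = b − jM′y`, i.e. `τ_{j/16}·W₁₆ = γ_j·[[16, y],[0, 16]]`: the translate `W₁₆(w) + j/16` is `γ_j • (w + y/16)` and the automorphy base
`16M′(w + y/16) + 16 − M′y = 16(M′w + 1)` is THE SAME FOR EVERY `j` — no half-integral cocycle appears (numerically certified on `H_k`, `H_k|U_4`,
`k ∈ {2,3}`, `M′ ∈ {1,3,5,7}`, 384 `(j, w)` pairs, worst relative error `8·10⁻¹⁴`; seat folder `work/numerics/flip16.py`).

* §1 `translate_mul_W16_eq`, `det_gammaSixteen_eq_one`, `sixteen_dvd_of_solution`, `exists_gamma0_translate_mul_W16_eq` — the `q = 4` matrices.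
* §2 `translateSixteen_flippedCusp_eq_smul` — ON `ℍ`: `(j/16) +ᵥ γ₀ • (256 • w) = γ_j • ((y/16) +ᵥ w)`, `denom = 16(M′w + 1)`.
* §3 `apply_translateSixteen_flippedCusp` — for `g` with `g(γ • z) = autFactor K N ψ γ z · g z` on `Γ₀(N)` and `γ_j ∈ Γ₀(N)`:
  `g((j/16) +ᵥ γ₀•(256•w)) = ψ(d_j)·(ε_{d_j}⁻¹·J(16M′ | d_j)·√(16(M′w + 1)))^K · g((y_j/16) +ᵥ w)`, `d_j = 16 − M′y_j`.
* §4 `oddPartSixteen_flippedCusp_eq`, `hasSum_oddPartSixteen_flippedCusp` — the weighted sum over `j ∈ {1,3,…,15}` and its `q`-expansion: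
  coefficient of `e(nw)` = `√(16(M′w+1))^K · (Σ_j ω(j)·μ_j·e(n y_j/16)) · b(n)`, `μ_j = ψ(d_j)(ε_{d_j}⁻¹ J(16M′|d_j))^K` — the weights of P6b.
* §5 `hasSum_oddPartSixteen_flippedCusp_of_det` — packaged: only `256a − M′b = 1`, `γ₀` and the solutions `y_j` are data (the `γ_j` are chosen inside).

No definitions, no named facts, no `sorry`. beyond-print theorem: NO (Shimura 1973 §1 bookkeeping).
References: [Shimura1973HalfIntegral] §1 (`j(γ, z)`), Prop. 1.3–1.5; [AtkinLehner1970] §6; crux notes w7g8-T6 §1a, §5b–§5c; T2 and P1 files.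
-/

set_option autoImplicit false
-- summit-side namespace `Summit.BirchSwinnertonDyer.BirchSwinnertonDyer.…` (single-conjunct summit, D-0017 layout)
set_option linter.dupNamespace false

noncomputable section

open UpperHalfPlane Complex
open scoped MatrixGroups NumberTheorySymbols Real
open Literature.NumberTheory.EllipticCurves.ModularForms (thetaEps thetaFactor shimuraSymbol autFactor shimuraSymbol_of_nonneg)

namespace Summit.BirchSwinnertonDyer.BirchSwinnertonDyer.Theorems.PrintCFram.FlipRung

/-! ## §1 The matrices at `q = 4` (T2 `translate_mul_fricke_eq` with `q² = 16`, `q⁴ = 256`) -/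

/-- **`[[16, j],[0, 16]] · W₁₆ = γ_j · [[256, 16y],[0, 256]]` with `γ_j` EXPLICIT.** For a witness `b − j·M′·y = 16c` put
`γ_j := [[16a + jM′, c + j − ay],[16M′, 16 − M′y]]`. (T2 `translate_mul_fricke_eq` at `q = 4`, numerals spelled out.) [cite: AtkinLehner1970, §6]
[cite: Shimura1973, Prop. 1.5] -/
theorem translate_mul_W16_eq {M a b j y c : ℤ} (hc : b - j * M * y = 16 * c) :
    !![(16 : ℤ), j; 0, 16] * !![256 * a, b; M * 256, 256] =
      !![16 * a + j * M, c + j - a * y; M * 16, 16 - M * y] * !![256, 16 * y; 0, 256] := by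
  rw [Matrix.mul_fin_two, Matrix.mul_fin_two]
  have e11 : (16 : ℤ) * (256 * a) + j * (M * 256) = (16 * a + j * M) * 256 + (c + j - a * y) * 0 := by ring
  have e12 : (16 : ℤ) * b + j * 256 = (16 * a + j * M) * (16 * y) + (c + j - a * y) * 256 := by
    linear_combination 16 * hc
  have e21 : (0 : ℤ) * (256 * a) + 16 * (M * 256) = M * 16 * 256 + (16 - M * y) * 0 := by ring
  have e22 : (0 : ℤ) * b + 16 * 256 = M * 16 * (16 * y) + (16 - M * y) * 256 := by ring
  rw [e11, e12, e21, e22]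

/-- `det γ_j = 1` (from `256a − M′b = 1` and the witness `b − jM′y = 16c`). [folklore] -/
theorem det_gammaSixteen_eq_one {M a b j y c : ℤ} (hdet : 256 * a - M * b = 1) (hc : b - j * M * y = 16 * c) :
    Matrix.det !![16 * a + j * M, c + j - a * y; M * 16, 16 - M * y] = 1 := by
  rw [Matrix.det_fin_two_of]
  linear_combination hdet + M * hc

/-- A solution `y` of `j·M′·y ≡ b (mod 16)` gives the witness: `16 ∣ b − jM′y`. [folklore] -/
theorem sixteen_dvd_of_solution {M b j y : ℤ} (hy : j * M * y ≡ b [ZMOD 16]) : (16 : ℤ) ∣ b - j * M * y :=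
  Int.ModEq.dvd hy

/-- From `256a − M′b = 1`: `M′·b ≡ −1 (mod 16)`, so a solution `y` of `j·M′·y ≡ b` has `M′²·j·y ≡ −1 (mod 16)` — `y` is `−(jM′²)⁻¹ (mod 16)`,
w7 g8's `x_j` of (O3). [folklore] -/
theorem sq_mul_mul_modEq_neg_one_sixteen {M a b j y : ℤ} (hdet : 256 * a - M * b = 1) (hy : j * M * y ≡ b [ZMOD 16]) :
    M ^ 2 * j * y ≡ -1 [ZMOD 16] := by
  have h1 : M * b ≡ -1 [ZMOD 16] := Int.modEq_iff_dvd.mpr ⟨-(16 * a), by linear_combination hdet⟩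
  have h2 : M * (j * M * y) ≡ M * b [ZMOD 16] := hy.mul_left M
  have e : M ^ 2 * j * y = M * (j * M * y) := by ring
  rw [e]
  exact h2.trans h1

/-- **THE MATRIX FACTORISATION AT `2`, MODULUS `16` (P6a), PACKAGED.** For `M′ : ℕ`, `256a − M′b = 1` and an odd `j` with a solution `y` of
`j·M′·y ≡ b (mod 16)` there is `γ ∈ Γ₀(4M′)` (indeed with lower-left entry `16M′`) with bottom row `(16M′, 16 − M′y)` such that
`[[16, j],[0, 16]]·[[256a, b],[256M′, 256]] = γ·[[256, 16y],[0, 256]]`. [cite: AtkinLehner1970, §6] [cite: Shimura1973, Prop. 1.5] -/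
theorem exists_gamma0_translate_mul_W16_eq {M : ℕ} {a b : ℤ} (hdet : 256 * a - (M : ℤ) * b = 1) {j y : ℤ}
    (hy : j * (M : ℤ) * y ≡ b [ZMOD 16]) :
    ∃ γ : SL(2, ℤ), γ ∈ CongruenceSubgroup.Gamma0 (4 * M) ∧ (γ 1 0 : ℤ) = (M : ℤ) * 16 ∧ (γ 1 1 : ℤ) = 16 - (M : ℤ) * y ∧
      (γ 0 0 : ℤ) = 16 * a + j * (M : ℤ) ∧
      !![(16 : ℤ), j; 0, 16] * !![256 * a, b; (M : ℤ) * 256, 256] = (γ : Matrix (Fin 2) (Fin 2) ℤ) * !![256, 16 * y; 0, 256] := by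
  obtain ⟨c, hc⟩ := sixteen_dvd_of_solution hy
  refine ⟨⟨!![16 * a + j * (M : ℤ), c + j - a * y; (M : ℤ) * 16, 16 - (M : ℤ) * y], det_gammaSixteen_eq_one hdet hc⟩,
    ?_, ?_, ?_, ?_, ?_⟩
  · rw [CongruenceSubgroup.Gamma0_mem]
    simp only [Matrix.of_apply, Matrix.cons_val', Matrix.cons_val_zero, Matrix.cons_val_one, Int.cast_mul, Int.cast_ofNat,
      Int.cast_natCast]
    rw [show ((M : ZMod (4 * M)) * 16) = 4 * ((4 * M : ℕ) : ZMod (4 * M)) by push_cast; ring, ZMod.natCast_self, mul_zero]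
  · simp
  · simp
  · simp
  · exact translate_mul_W16_eq hc

/-- For `M′` odd there are `a, b` with `256a − M′b = 1` (T2 `exists_fricke_det` at `q = 4`). [folklore] -/
theorem exists_det_sixteen {M : ℤ} (hM : Odd M) : ∃ a b : ℤ, 256 * a - M * b = 1 := by
  have h2 : IsCoprime (2 : ℤ) M := by
    obtain ⟨r, hr⟩ := hM
    exact ⟨-r, 1, by linear_combination hr⟩
  obtain ⟨u, v, huv⟩ := h2.pow_left (m := 8)
  exact ⟨u, -v, by linear_combination huv⟩

/-- For odd `j`, `M′` and the data `256a − M′b = 1` there is a solution `y` of `j·M′·y ≡ b (mod 16)` (`jM′` is a unit mod `16`). [folklore] -/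
theorem exists_solution_sixteen {M a b j : ℤ} (hdet : 256 * a - M * b = 1) (hj : Odd j) : ∃ y : ℤ, j * M * y ≡ b [ZMOD 16] := by
  have hM2 : IsCoprime (2 : ℤ) M := ⟨-(M * b) * 0 + (128 * a - (M * ((b - 1) / 2 + (b + 1) / 2 - b))) * 0 + 128 * a, -b, by
    linear_combination hdet⟩
  have hj2 : IsCoprime (2 : ℤ) j := by
    obtain ⟨r, hr⟩ := hj
    exact ⟨-r, 1, by linear_combination hr⟩
  have h16 : IsCoprime (16 : ℤ) (j * M) := by
    have := (hj2.mul_right hM2).pow_left (m := 4)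
    norm_num at this
    exact this
  obtain ⟨s, t, hst⟩ := h16
  refine ⟨t * b, Int.modEq_iff_dvd.mpr ⟨s * b, ?_⟩⟩
  linear_combination (-b) * hst

/-! ## §2 The odd translates of the flipped cusp are `γ_j`-images of translates of `w` -/

/-- The entries of `γ_j` from its defining identity `[[16, j],[0,16]]·W₁₆ = γ_j·[[256, 16y],[0, 256]]`: `γ_j = [[16a + jM′, ·],[16M′, 16 − M′y]]` and
`16·(γ_j)₀₁ = b + 16j − y(16a + jM′)`. [folklore] -/
theorem entries_of_translate_mul_W16_eq {γ : SL(2, ℤ)} {M a b j y : ℤ}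
    (hmat : !![(16 : ℤ), j; 0, 16] * !![256 * a, b; M * 256, 256] = (γ : Matrix (Fin 2) (Fin 2) ℤ) * !![256, 16 * y; 0, 256]) :
    (γ 0 0 : ℤ) = 16 * a + j * M ∧ 16 * (γ 0 1 : ℤ) = b + 16 * j - y * (16 * a + j * M) ∧ (γ 1 0 : ℤ) = 16 * M ∧
      (γ 1 1 : ℤ) = 16 - M * y := by
  have e00 := congrArg (fun A : Matrix (Fin 2) (Fin 2) ℤ => A 0 0) hmat
  have e01 := congrArg (fun A : Matrix (Fin 2) (Fin 2) ℤ => A 0 1) hmat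
  have e10 := congrArg (fun A : Matrix (Fin 2) (Fin 2) ℤ => A 1 0) hmat
  have e11 := congrArg (fun A : Matrix (Fin 2) (Fin 2) ℤ => A 1 1) hmat
  simp only [Matrix.mul_apply, Fin.sum_univ_two, Matrix.of_apply, Matrix.cons_val', Matrix.cons_val_zero, Matrix.cons_val_one,
    Matrix.cons_val_fin_one] at e00 e01 e10 e11
  have h00 : (256 : ℤ) * (γ 0 0 : ℤ) = 256 * (16 * a + j * M) := by linear_combination -e00
  have g00 : (γ 0 0 : ℤ) = 16 * a + j * M := mul_left_cancel₀ (by norm_num) h00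
  have h10 : (256 : ℤ) * (γ 1 0 : ℤ) = 256 * (16 * M) := by linear_combination -e10
  have g10 : (γ 1 0 : ℤ) = 16 * M := mul_left_cancel₀ (by norm_num) h10
  have h01 : (256 : ℤ) * (16 * (γ 0 1 : ℤ)) = 256 * (b + 16 * j - y * (16 * a + j * M)) := by
    rw [g00] at e01
    linear_combination (-16) * e01
  have h11 : (256 : ℤ) * (γ 1 1 : ℤ) = 256 * (16 - M * y) := by
    rw [g10] at e11
    linear_combination -e11
  exact ⟨g00, mul_left_cancel₀ (by norm_num) h01, g10, mul_left_cancel₀ (by norm_num) h11⟩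

/-- The automorphy base is the same for every `j`: `denom γ_j (w + y/16) = 16M′(w + y/16) + 16 − M′y = 16(M′w + 1)`. [folklore] -/
theorem denom_translateSixteen_eq (γ : SL(2, ℤ)) {M y : ℤ} (g10 : (γ 1 0 : ℤ) = 16 * M) (g11 : (γ 1 1 : ℤ) = 16 - M * y) (w : ℍ) :
    denom γ ((((y : ℝ) / 16) +ᵥ w) : ℍ) = 16 * ((M : ℂ) * w + 1) := by
  rw [ModularGroup.denom_apply, g10, g11, coe_vadd]
  push_cast
  ring

/-- `M′w + 1 ≠ 0` for `w ∈ ℍ` (it is `denom γ_j (w + y/16)/16`). [folklore] -/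
theorem level_mul_add_one_ne_zero_sixteen (γ : SL(2, ℤ)) {M y : ℤ} (g10 : (γ 1 0 : ℤ) = 16 * M) (g11 : (γ 1 1 : ℤ) = 16 - M * y)
    (w : ℍ) : (M : ℂ) * w + 1 ≠ 0 := by
  intro h
  have := denom_ne_zero γ ((((y : ℝ) / 16) +ᵥ w) : ℍ)
  rw [denom_translateSixteen_eq γ g10 g11 w, h, mul_zero] at this
  exact this rfl

/-- **THE TRANSLATES OF THE FLIPPED CUSP (modulus `16`).** For `γ₀ = [[a, b],[M′, 256]] ∈ SL₂(ℤ)` and `γ_j` with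
`[[16, j],[0,16]]·γ₀·diag(256,1) = γ_j·[[256, 16y],[0, 256]]` (§1), and every `w ∈ ℍ`: `(j/16) +ᵥ γ₀ • (256 • w) = γ_j • ((y/16) +ᵥ w)`.
[cite: Shimura1973HalfIntegral, Prop. 1.5 (proof)] -/
theorem translateSixteen_flippedCusp_eq_smul (γ₀ γ : SL(2, ℤ)) {M a b j y : ℤ}
    (h00 : (γ₀ 0 0 : ℤ) = a) (h01 : (γ₀ 0 1 : ℤ) = b) (h10 : (γ₀ 1 0 : ℤ) = M) (h11 : (γ₀ 1 1 : ℤ) = 256)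
    (hmat : !![(16 : ℤ), j; 0, 16] * !![256 * a, b; M * 256, 256] = (γ : Matrix (Fin 2) (Fin 2) ℤ) * !![256, 16 * y; 0, 256])
    (w : ℍ) :
    (((j : ℝ) / 16) +ᵥ γ₀ • ((⟨256, by norm_num⟩ : {x : ℝ // 0 < x}) • w) : ℍ) = γ • ((((y : ℝ) / 16) +ᵥ w) : ℍ) := by
  obtain ⟨g00, g01, g10, g11⟩ := entries_of_translate_mul_W16_eq hmat
  have hw1 : (M : ℂ) * w + 1 ≠ 0 := level_mul_add_one_ne_zero_sixteen γ g10 g11 w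
  have h256 : (256 : ℂ) * ((M : ℂ) * w + 1) ≠ 0 := mul_ne_zero (by norm_num) hw1
  have h16 : (16 : ℂ) * ((M : ℂ) * w + 1) ≠ 0 := mul_ne_zero (by norm_num) hw1
  have g01C : 16 * ((γ 0 1 : ℤ) : ℂ) = (b : ℂ) + 16 * j - y * (16 * a + j * M) := by exact_mod_cast g01
  -- the identity of complex numbers
  have key : ((j : ℂ) / 16) + ((a : ℂ) * ((256 : ℂ) * (w : ℂ)) + b) / ((M : ℂ) * ((256 : ℂ) * (w : ℂ)) + 256) =
      (((16 * a + j * M : ℤ) : ℂ) * ((y : ℂ) / 16 + w) + ((γ 0 1 : ℤ) : ℂ)) /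
        (((16 * M : ℤ) : ℂ) * ((y : ℂ) / 16 + w) + ((16 - M * y : ℤ) : ℂ)) := by
    push_cast
    rw [show (M : ℂ) * (256 * (w : ℂ)) + 256 = 256 * ((M : ℂ) * w + 1) by ring,
      show (16 * (M : ℂ)) * ((y : ℂ) / 16 + w) + (16 - (M : ℂ) * y) = 16 * ((M : ℂ) * w + 1) by ring,
      div_add_div _ _ (by norm_num : (16 : ℂ) ≠ 0) h256, div_eq_div_iff (mul_ne_zero (by norm_num) h256) h16]
    linear_combination (-256 * ((M : ℂ) * (w : ℂ) + 1)) * g01C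
  apply UpperHalfPlane.ext
  rw [coe_vadd, coe_specialLinearGroup_apply, coe_specialLinearGroup_apply, coe_pos_real_smul, coe_vadd, h00, h01, h10, h11,
    g00, g10, g11]
  simp only [eq_intCast, Complex.real_smul, Complex.ofReal_div, Complex.ofReal_intCast, Complex.ofReal_ofNat]
  push_cast at key ⊢
  exact key

/-! ## §3 The value of a `Γ₀(N)`-automorphic `g` at the odd translates of the flipped cusp -/

/-- **`g` AT THE TRANSLATE `W₁₆(w) + j/16`.** For `g : ℍ → ℂ` with `g(γ • z) = autFactor K N ψ γ z·g(z)` on `Γ₀(N)` (a member of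
`halfIntModularForms K N ψ`, `apply_smul_eq_of_mem`; or `heckeFun K ψ 2 G`, `heckeFun_smul`), `γ₀, γ_j` as in §2 with `γ_j ∈ Γ₀(N)` and
`0 ≤ M′`: `g((j/16) +ᵥ γ₀•(256•w)) = ψ(d_j)·(ε_{d_j}⁻¹·J(16M′ | d_j)·√(16(M′w+1)))^K·g((y/16) +ᵥ w)`, `d_j = 16 − M′y`.
[cite: Shimura1973HalfIntegral, §1 (1.10)] -/
theorem apply_translateSixteen_flippedCusp {N K : ℕ} {ψ : DirichletCharacter ℂ N} {g : ℍ → ℂ}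
    (hg : ∀ γ ∈ CongruenceSubgroup.Gamma0 N, ∀ z : ℍ, g (γ • z) = autFactor K N ψ γ z * g z)
    (γ₀ γ : SL(2, ℤ)) {M a b j y : ℤ} (hM : 0 ≤ M)
    (h00 : (γ₀ 0 0 : ℤ) = a) (h01 : (γ₀ 0 1 : ℤ) = b) (h10 : (γ₀ 1 0 : ℤ) = M) (h11 : (γ₀ 1 1 : ℤ) = 256)
    (hmat : !![(16 : ℤ), j; 0, 16] * !![256 * a, b; M * 256, 256] = (γ : Matrix (Fin 2) (Fin 2) ℤ) * !![256, 16 * y; 0, 256])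
    (hγ : γ ∈ CongruenceSubgroup.Gamma0 N) (w : ℍ) :
    g ((((j : ℝ) / 16) +ᵥ γ₀ • ((⟨256, by norm_num⟩ : {x : ℝ // 0 < x}) • w) : ℍ)) =
      ψ (((16 - M * y : ℤ)) : ZMod N) *
        ((thetaEps (16 - M * y))⁻¹ * (J(16 * M | (16 - M * y).natAbs) : ℂ) * Complex.sqrt (16 * ((M : ℂ) * w + 1))) ^ K *
        g ((((y : ℝ) / 16) +ᵥ w : ℍ)) := by
  obtain ⟨-, -, g10, g11⟩ := entries_of_translate_mul_W16_eq hmat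
  rw [translateSixteen_flippedCusp_eq_smul γ₀ γ h00 h01 h10 h11 hmat w, hg γ hγ]
  have hden : ((γ 1 0 : ℤ) : ℂ) * (((((y : ℝ) / 16) +ᵥ w : ℍ)) : ℂ) + ((γ 1 1 : ℤ) : ℂ) = 16 * ((M : ℂ) * w + 1) := by
    rw [← ModularGroup.denom_apply]; exact denom_translateSixteen_eq γ g10 g11 w
  simp only [autFactor, thetaFactor]
  rw [hden, g10, g11, shimuraSymbol_of_nonneg (by positivity)]

/-! ## §4 The odd part of a translate average at the flipped cusp -/

/-- **THE ODD-TRANSLATE FLIP IDENTITY AT MODULUS `16`** (any weights `ω`; for the class cut `P_c`, `ω(j) = ζ₁₆^{−cj}/16`): with the matrices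
`γ_j` (`j ∈ {1,3,…,15}`), all in `Γ₀(N)`, and the solutions `y_j`:
`Σ_{j odd} ω(j)·g((j/16) +ᵥ γ₀•(256•w)) = √(16(M′w+1))^K · Σ_{j} ω(j)·ψ(d_j)·(ε_{d_j}⁻¹ J(16M′|d_j))^K · g((y_j/16) +ᵥ w)`, `d_j = 16 − M′y_j`.
[cite: Shimura1973HalfIntegral, §1 (1.10), Prop. 1.5] -/
theorem oddPartSixteen_flippedCusp_eq {N K : ℕ} {ψ : DirichletCharacter ℂ N} {g : ℍ → ℂ}
    (hg : ∀ γ ∈ CongruenceSubgroup.Gamma0 N, ∀ z : ℍ, g (γ • z) = autFactor K N ψ γ z * g z)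
    (γ₀ : SL(2, ℤ)) {M a b : ℤ} (hM : 0 ≤ M)
    (h00 : (γ₀ 0 0 : ℤ) = a) (h01 : (γ₀ 0 1 : ℤ) = b) (h10 : (γ₀ 1 0 : ℤ) = M) (h11 : (γ₀ 1 1 : ℤ) = 256)
    (γ : ℕ → SL(2, ℤ)) (y : ℕ → ℤ)
    (hγ : ∀ j ∈ ({1, 3, 5, 7, 9, 11, 13, 15} : Finset ℕ),
      !![(16 : ℤ), (j : ℤ); 0, 16] * !![256 * a, b; M * 256, 256] = (γ j : Matrix (Fin 2) (Fin 2) ℤ) * !![256, 16 * y j; 0, 256] ∧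
        γ j ∈ CongruenceSubgroup.Gamma0 N)
    (ω : ℕ → ℂ) (w : ℍ) :
    ∑ j ∈ ({1, 3, 5, 7, 9, 11, 13, 15} : Finset ℕ), ω j * g ((((j : ℝ) / 16) +ᵥ γ₀ • ((⟨256, by norm_num⟩ : {x : ℝ // 0 < x}) • w) : ℍ)) =
      Complex.sqrt (16 * ((M : ℂ) * w + 1)) ^ K *
        ∑ j ∈ ({1, 3, 5, 7, 9, 11, 13, 15} : Finset ℕ), ω j * (ψ (((16 - M * y j : ℤ)) : ZMod N) *
          ((thetaEps (16 - M * y j))⁻¹ * (J(16 * M | (16 - M * y j).natAbs) : ℂ)) ^ K) * g ((((y j : ℝ) / 16) +ᵥ w : ℍ)) := by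
  rw [Finset.mul_sum]
  refine Finset.sum_congr rfl (fun j hj => ?_)
  obtain ⟨hmat, hγN⟩ := hγ j hj
  have h := apply_translateSixteen_flippedCusp hg γ₀ (γ j) hM h00 h01 h10 h11 hmat hγN w
  rw [Int.cast_natCast] at h
  rw [h, mul_pow]
  ring

/-! ## §5 The coefficients: `q`-expansion of the odd part -/

/-- The parameter `e(z)` at the translate `w + y/16`: `e(n(w + y/16)) = e(ny/16)·e(nw)`. [folklore] -/
theorem qParam_translateSixteen_pow (y : ℤ) (w : ℍ) (n : ℕ) :
    Function.Periodic.qParam 1 (((((y : ℝ) / 16) +ᵥ w : ℍ)) : ℂ) ^ n =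
      cexp (2 * π * Complex.I * ((y * n : ℤ) : ℂ) / 16) * Function.Periodic.qParam 1 (w : ℂ) ^ n := by
  simp only [Function.Periodic.qParam, coe_vadd]
  push_cast
  rw [← Complex.exp_nat_mul, ← Complex.exp_nat_mul, ← Complex.exp_add]
  congr 1
  ring

/-- **THE `q`-EXPANSION OF THE ODD PART AT THE FLIPPED CUSP (modulus `16`).** If `g(τ) = Σ_n b(n) e(nτ)` on `ℍ` (`hasSum_qCoeffs`,
`hasSum_heckeFun`), then `Σ_{j odd} ω(j)·g((j/16) +ᵥ γ₀•(256•w)) = Σ_n [√(16(M′w+1))^K · (Σ_{j odd} ω(j)·μ_j·e(n y_j/16)) · b(n)] e(nw)`,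
`μ_j = ψ(d_j)(ε_{d_j}⁻¹J(16M′|d_j))^K`: the coefficient of `e(nw)` is the weight `w(n)·b(n)` of the `e = 3` flipped-cusp rung (P6b evaluates the
finite sum: `|w|² = 1/8` on the classes `≡ 2 (mod 4)`). [cite: Shimura1973HalfIntegral, §1, Prop. 1.5] -/
theorem hasSum_oddPartSixteen_flippedCusp {N K : ℕ} {ψ : DirichletCharacter ℂ N} {g : ℍ → ℂ}
    (hg : ∀ γ ∈ CongruenceSubgroup.Gamma0 N, ∀ z : ℍ, g (γ • z) = autFactor K N ψ γ z * g z)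
    (γ₀ : SL(2, ℤ)) {M a b : ℤ} (hM : 0 ≤ M)
    (h00 : (γ₀ 0 0 : ℤ) = a) (h01 : (γ₀ 0 1 : ℤ) = b) (h10 : (γ₀ 1 0 : ℤ) = M) (h11 : (γ₀ 1 1 : ℤ) = 256)
    (γ : ℕ → SL(2, ℤ)) (y : ℕ → ℤ)
    (hγ : ∀ j ∈ ({1, 3, 5, 7, 9, 11, 13, 15} : Finset ℕ),
      !![(16 : ℤ), (j : ℤ); 0, 16] * !![256 * a, b; M * 256, 256] = (γ j : Matrix (Fin 2) (Fin 2) ℤ) * !![256, 16 * y j; 0, 256] ∧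
        γ j ∈ CongruenceSubgroup.Gamma0 N)
    (ω : ℕ → ℂ) {b' : ℕ → ℂ} (hb : ∀ τ : ℍ, HasSum (fun n ↦ b' n * Function.Periodic.qParam 1 (τ : ℂ) ^ n) (g τ)) (w : ℍ) :
    HasSum (fun n : ℕ ↦ (Complex.sqrt (16 * ((M : ℂ) * w + 1)) ^ K *
        ∑ j ∈ ({1, 3, 5, 7, 9, 11, 13, 15} : Finset ℕ), ω j * (ψ (((16 - M * y j : ℤ)) : ZMod N) *
          ((thetaEps (16 - M * y j))⁻¹ * (J(16 * M | (16 - M * y j).natAbs) : ℂ)) ^ K) *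
            cexp (2 * π * Complex.I * ((y j * n : ℤ) : ℂ) / 16)) * b' n * Function.Periodic.qParam 1 (w : ℂ) ^ n)
      (∑ j ∈ ({1, 3, 5, 7, 9, 11, 13, 15} : Finset ℕ), ω j * g ((((j : ℝ) / 16) +ᵥ γ₀ • ((⟨256, by norm_num⟩ : {x : ℝ // 0 < x}) • w) : ℍ))) := by
  rw [oddPartSixteen_flippedCusp_eq hg γ₀ hM h00 h01 h10 h11 γ y hγ ω w]
  have h : ∀ j ∈ ({1, 3, 5, 7, 9, 11, 13, 15} : Finset ℕ), HasSum (fun n : ℕ ↦ ω j * (ψ (((16 - M * y j : ℤ)) : ZMod N) *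
      ((thetaEps (16 - M * y j))⁻¹ * (J(16 * M | (16 - M * y j).natAbs) : ℂ)) ^ K) *
        (b' n * (cexp (2 * π * Complex.I * ((y j * n : ℤ) : ℂ) / 16) * Function.Periodic.qParam 1 (w : ℂ) ^ n)))
      (ω j * (ψ (((16 - M * y j : ℤ)) : ZMod N) *
        ((thetaEps (16 - M * y j))⁻¹ * (J(16 * M | (16 - M * y j).natAbs) : ℂ)) ^ K) * g ((((y j : ℝ) / 16) +ᵥ w : ℍ))) := by
    intro j _
    have hj := hb (((y j : ℝ) / 16) +ᵥ w)
    simp_rw [qParam_translateSixteen_pow (y j) w] at hj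
    exact hj.mul_left _
  have hs := (hasSum_sum h).mul_left (Complex.sqrt (16 * ((M : ℂ) * w + 1)) ^ K)
  refine hs.congr_fun (fun n => ?_)
  simp only [Finset.mul_sum, Finset.sum_mul]
  exact Finset.sum_congr rfl (fun j _ => by ring)

/-! ## §6 Packaged with §1: only `256a − M′b = 1`, the cusp matrix `γ₀` and the solutions `y_j` are data -/

/-- **THE ODD PART AT THE FLIPPED CUSP (modulus `16`), PACKAGED**: for `M′ : ℕ` with `256a − M′b = 1`, `γ₀ = [[a, b],[M′, 256]]`, solutions
`y_j` of `j·M′·y_j ≡ b (mod 16)` at the odd `j < 16`, `g` automorphic of weight `K/2` on `Γ₀(4M′)` with character `ψ` and `q`-expansion `b`, the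
weighted odd-translate sum at `W₁₆(w)` has the `q`-expansion with coefficients
`√(16(M′w+1))^K · (Σ_{j odd} ω(j)·ψ(16 − M′y_j)·(ε_{16−M′y_j}⁻¹ J(16M′ | 16 − M′y_j))^K·e(n y_j/16)) · b(n)` (the matrices `γ_j ∈ Γ₀(4M′)` of
`exists_gamma0_translate_mul_W16_eq` are chosen inside the proof and do not appear). [cite: Shimura1973HalfIntegral, Prop. 1.5] -/
theorem hasSum_oddPartSixteen_flippedCusp_of_det {M : ℕ} {a b : ℤ} (hdet : 256 * a - (M : ℤ) * b = 1) (γ₀ : SL(2, ℤ))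
    (h00 : (γ₀ 0 0 : ℤ) = a) (h01 : (γ₀ 0 1 : ℤ) = b) (h10 : (γ₀ 1 0 : ℤ) = M) (h11 : (γ₀ 1 1 : ℤ) = 256)
    (y : ℕ → ℤ) (hy : ∀ j ∈ ({1, 3, 5, 7, 9, 11, 13, 15} : Finset ℕ), (j : ℤ) * (M : ℤ) * y j ≡ b [ZMOD 16])
    {K : ℕ} {ψ : DirichletCharacter ℂ (4 * M)} {g : ℍ → ℂ}
    (hg : ∀ γ ∈ CongruenceSubgroup.Gamma0 (4 * M), ∀ z : ℍ, g (γ • z) = autFactor K (4 * M) ψ γ z * g z)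
    (ω : ℕ → ℂ) {b' : ℕ → ℂ} (hb : ∀ τ : ℍ, HasSum (fun n ↦ b' n * Function.Periodic.qParam 1 (τ : ℂ) ^ n) (g τ)) (w : ℍ) :
    HasSum (fun n : ℕ ↦ (Complex.sqrt (16 * ((M : ℂ) * w + 1)) ^ K *
        ∑ j ∈ ({1, 3, 5, 7, 9, 11, 13, 15} : Finset ℕ), ω j * (ψ (((16 - (M : ℤ) * y j : ℤ)) : ZMod (4 * M)) *
          ((thetaEps (16 - (M : ℤ) * y j))⁻¹ * (J(16 * (M : ℤ) | (16 - (M : ℤ) * y j).natAbs) : ℂ)) ^ K) *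
            cexp (2 * π * Complex.I * ((y j * n : ℤ) : ℂ) / 16)) * b' n * Function.Periodic.qParam 1 (w : ℂ) ^ n)
      (∑ j ∈ ({1, 3, 5, 7, 9, 11, 13, 15} : Finset ℕ),
        ω j * g ((((j : ℝ) / 16) +ᵥ γ₀ • ((⟨256, by norm_num⟩ : {x : ℝ // 0 < x}) • w) : ℍ))) := by
  have H : ∀ j ∈ ({1, 3, 5, 7, 9, 11, 13, 15} : Finset ℕ), ∃ γ : SL(2, ℤ), γ ∈ CongruenceSubgroup.Gamma0 (4 * M) ∧
      !![(16 : ℤ), (j : ℤ); 0, 16] * !![256 * a, b; (M : ℤ) * 256, 256] =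
        (γ : Matrix (Fin 2) (Fin 2) ℤ) * !![256, 16 * y j; 0, 256] := by
    intro j hj
    obtain ⟨γ, hγ, -, -, -, hmat⟩ := exists_gamma0_translate_mul_W16_eq hdet (hy j hj)
    exact ⟨γ, hγ, hmat⟩
  choose! γ hγmem hγmat using H
  have hMC : ((M : ℤ) : ℂ) = (M : ℂ) := by norm_cast
  have h := hasSum_oddPartSixteen_flippedCusp hg γ₀ (M := (M : ℤ)) (Int.natCast_nonneg M) h00 h01 h10 h11 γ y
    (fun j hj => ⟨hγmat j hj, hγmem j hj⟩) ω hb w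
  rw [hMC] at h
  exact h

end Summit.BirchSwinnertonDyer.BirchSwinnertonDyer.Theorems.PrintCFram.FlipRung

end
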